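import Summits.CriticalPhenomena.PercolationContinuityZ3.Theorems.PercNearOneGluingNoHeavyConstsLinearLowerTailStarCore
import Summits.CriticalPhenomena.PercolationContinuityZ3.Theorems.PercNearOneGluingAdditiveGluingKnThm2GoodEvents
import HarnessLib

/-!
# TS / DUU: permutation symmetry and degenerate triples (glue for assembling the kernel classes)

builds on p205010 (kernel theorem, internal audit signed; external expert review pending)

Lane `prim/consts`, seat prim-consts-1 gen 11, helper file for the crux `NoHeavyLowerTail`
(stmt-CriticalPhenomena-4575; `--supports`): theorems only, no definitions, no sorries, standard axioms.

The kernel classes for TS (`Consts.TripleSplit`) and DUU (`Consts.RootedSplit`) landed in gen 11 — stars, cut vertices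
(`Consts.tripleSplit_cutVertex`), arc systems / cycles with attachments (`Consts.tripleSplit_cycle`), branch gluing
(`Consts.tripleSplit_branch`) — each conclude the inequality for ONE ordering of the triple.  Chaining them (e.g. cycle ⇒ branch gluing ⇒
branch gluing for three vertices hanging off a cycle at distinct anchors) needs the orderings to match; this file supplies the permutation
invariance (`Consts.tripleSplit_swap12`, `Consts.tripleSplit_swap23` generate `S₃`; `Consts.rootedSplit_swap` for the two non-root
terminals of DUU) and the degenerate triples with two equal terminals (left side `0`).
-/

namespace Summit.CriticalPhenomena.PercolationContinuityZ3.Theorems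

open MeasureTheory Set Literature.Probability.LatticeModels Literature.Probability.Percolation

namespace Consts

variable {n : ℕ}

/-- The three-way separation event is invariant under swapping the first two terminals. [folklore] -/
theorem tripleSep_swap12 (a b c : Fin n) :
    ((openConn a b)ᶜ ∩ (openConn a c)ᶜ ∩ (openConn b c)ᶜ : Set (BondConfig (Fin n))) =
      (openConn b a)ᶜ ∩ (openConn b c)ᶜ ∩ (openConn a c)ᶜ := by
  rw [knThm2_openConn_comm a b]; ext ω; simp only [Set.mem_inter_iff]; tauto

/-- The three-way separation event is invariant under swapping the last two terminals. [folklore] -/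
theorem tripleSep_swap23 (a b c : Fin n) :
    ((openConn a b)ᶜ ∩ (openConn a c)ᶜ ∩ (openConn b c)ᶜ : Set (BondConfig (Fin n))) =
      (openConn a c)ᶜ ∩ (openConn a b)ᶜ ∩ (openConn c b)ᶜ := by
  rw [knThm2_openConn_comm b c]; ext ω; simp only [Set.mem_inter_iff]; tauto

/-- **TS is invariant under swapping the first two terminals**: TS(a, b, c) ⇒ TS(b, a, c). [folklore] -/
theorem tripleSplit_swap12 (w : Sym2 (Fin n) → unitInterval) {a b c : Fin n}
    (h : (prodBernoulli w).real ((openConn a b)ᶜ ∩ (openConn a c)ᶜ ∩ (openConn b c)ᶜ) ^ 2 ≤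
      (prodBernoulli w).real (openConn a b)ᶜ * (prodBernoulli w).real (openConn a c)ᶜ *
        (prodBernoulli w).real (openConn b c)ᶜ) :
    (prodBernoulli w).real ((openConn b a)ᶜ ∩ (openConn b c)ᶜ ∩ (openConn a c)ᶜ) ^ 2 ≤
      (prodBernoulli w).real (openConn b a)ᶜ * (prodBernoulli w).real (openConn b c)ᶜ *
        (prodBernoulli w).real (openConn a c)ᶜ := by
  rw [← tripleSep_swap12 a b c, knThm2_openConn_comm b a]
  calc _ ≤ _ := h
    _ = _ := by ring

/-- **TS is invariant under swapping the last two terminals**: TS(a, b, c) ⇒ TS(a, c, b). [folklore] -/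
theorem tripleSplit_swap23 (w : Sym2 (Fin n) → unitInterval) {a b c : Fin n}
    (h : (prodBernoulli w).real ((openConn a b)ᶜ ∩ (openConn a c)ᶜ ∩ (openConn b c)ᶜ) ^ 2 ≤
      (prodBernoulli w).real (openConn a b)ᶜ * (prodBernoulli w).real (openConn a c)ᶜ *
        (prodBernoulli w).real (openConn b c)ᶜ) :
    (prodBernoulli w).real ((openConn a c)ᶜ ∩ (openConn a b)ᶜ ∩ (openConn c b)ᶜ) ^ 2 ≤
      (prodBernoulli w).real (openConn a c)ᶜ * (prodBernoulli w).real (openConn a b)ᶜ *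
        (prodBernoulli w).real (openConn c b)ᶜ := by
  rw [← tripleSep_swap23 a b c, knThm2_openConn_comm c b]
  calc _ ≤ _ := h
    _ = _ := by ring

/-- **TS under the cyclic shift** `(a, b, c) ↦ (b, c, a)` (composite of the two swaps). [folklore] -/
theorem tripleSplit_rotate (w : Sym2 (Fin n) → unitInterval) {a b c : Fin n}
    (h : (prodBernoulli w).real ((openConn a b)ᶜ ∩ (openConn a c)ᶜ ∩ (openConn b c)ᶜ) ^ 2 ≤
      (prodBernoulli w).real (openConn a b)ᶜ * (prodBernoulli w).real (openConn a c)ᶜ *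
        (prodBernoulli w).real (openConn b c)ᶜ) :
    (prodBernoulli w).real ((openConn b c)ᶜ ∩ (openConn b a)ᶜ ∩ (openConn c a)ᶜ) ^ 2 ≤
      (prodBernoulli w).real (openConn b c)ᶜ * (prodBernoulli w).real (openConn b a)ᶜ *
        (prodBernoulli w).real (openConn c a)ᶜ :=
  tripleSplit_swap23 w (tripleSplit_swap12 w h)

/-- **DUU is invariant under swapping the two non-root terminals**: DUU(a; b, c) ⇒ DUU(a; c, b). [folklore] -/
theorem rootedSplit_swap (w : Sym2 (Fin n) → unitInterval) {a b c : Fin n}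
    (h : (prodBernoulli w).real ((openConn a b)ᶜ ∩ (openConn a c)ᶜ ∩ (openConn b c)ᶜ) ^ 2 ≤
      (prodBernoulli w).real ((openConn a b)ᶜ ∩ (openConn a c)ᶜ) * (prodBernoulli w).real (openConn b c)ᶜ ^ 2) :
    (prodBernoulli w).real ((openConn a c)ᶜ ∩ (openConn a b)ᶜ ∩ (openConn c b)ᶜ) ^ 2 ≤
      (prodBernoulli w).real ((openConn a c)ᶜ ∩ (openConn a b)ᶜ) * (prodBernoulli w).real (openConn c b)ᶜ ^ 2 := by
  rw [← tripleSep_swap23 a b c, knThm2_openConn_comm c b, Set.inter_comm (openConn a c)ᶜ]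
  exact h

/-- TS for a degenerate triple `a = b` (left side `0`). [folklore] -/
theorem tripleSplit_of_eq12 (w : Sym2 (Fin n) → unitInterval) (a c : Fin n) :
    (prodBernoulli w).real ((openConn a a)ᶜ ∩ (openConn a c)ᶜ ∩ (openConn a c)ᶜ) ^ 2 ≤
      (prodBernoulli w).real (openConn a a)ᶜ * (prodBernoulli w).real (openConn a c)ᶜ *
        (prodBernoulli w).real (openConn a c)ᶜ := by
  have hself : (openConn a a : Set (BondConfig (Fin n)))ᶜ = ∅ := by
    rw [Set.compl_empty_iff]; exact Set.eq_univ_of_forall fun ω => SimpleGraph.Reachable.refl _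
  rw [hself, Set.empty_inter, Set.empty_inter, measureReal_empty, zero_pow two_ne_zero, zero_mul, zero_mul]

/-- TS for a degenerate triple `b = c` (left side `0`). [folklore] -/
theorem tripleSplit_of_eq23 (w : Sym2 (Fin n) → unitInterval) (a b : Fin n) :
    (prodBernoulli w).real ((openConn a b)ᶜ ∩ (openConn a b)ᶜ ∩ (openConn b b)ᶜ) ^ 2 ≤
      (prodBernoulli w).real (openConn a b)ᶜ * (prodBernoulli w).real (openConn a b)ᶜ *
        (prodBernoulli w).real (openConn b b)ᶜ := by
  have hself : (openConn b b : Set (BondConfig (Fin n)))ᶜ = ∅ := by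
    rw [Set.compl_empty_iff]; exact Set.eq_univ_of_forall fun ω => SimpleGraph.Reachable.refl _
  rw [hself, Set.inter_empty, measureReal_empty, zero_pow two_ne_zero, mul_zero]

/-- DUU for a degenerate triple with the two non-root terminals equal (left side `0`). [folklore] -/
theorem rootedSplit_of_eq23 (w : Sym2 (Fin n) → unitInterval) (a b : Fin n) :
    (prodBernoulli w).real ((openConn a b)ᶜ ∩ (openConn a b)ᶜ ∩ (openConn b b)ᶜ) ^ 2 ≤
      (prodBernoulli w).real ((openConn a b)ᶜ ∩ (openConn a b)ᶜ) * (prodBernoulli w).real (openConn b b)ᶜ ^ 2 := by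
  have hself : (openConn b b : Set (BondConfig (Fin n)))ᶜ = ∅ := by
    rw [Set.compl_empty_iff]; exact Set.eq_univ_of_forall fun ω => SimpleGraph.Reachable.refl _
  rw [hself, Set.inter_empty, measureReal_empty, zero_pow two_ne_zero, mul_zero]

/-- DUU for a degenerate triple with the root equal to a terminal (left side `0`). [folklore] -/
theorem rootedSplit_of_eq12 (w : Sym2 (Fin n) → unitInterval) (a c : Fin n) :
    (prodBernoulli w).real ((openConn a a)ᶜ ∩ (openConn a c)ᶜ ∩ (openConn a c)ᶜ) ^ 2 ≤
      (prodBernoulli w).real ((openConn a a)ᶜ ∩ (openConn a c)ᶜ) * (prodBernoulli w).real (openConn a c)ᶜ ^ 2 := by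
  have hself : (openConn a a : Set (BondConfig (Fin n)))ᶜ = ∅ := by
    rw [Set.compl_empty_iff]; exact Set.eq_univ_of_forall fun ω => SimpleGraph.Reachable.refl _
  rw [hself, Set.empty_inter, Set.empty_inter, measureReal_empty, zero_pow two_ne_zero, zero_mul]

end Consts

end Summit.CriticalPhenomena.PercolationContinuityZ3.Theorems
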